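import Mathlib
import HarnessLib
import Summits.HubbardSuperconductivity.HubbardSuperconductivity.Theorems.KLProgrammePerturbedFermiCurveNormalAngleLevelGap
import Summits.HubbardSuperconductivity.HubbardSuperconductivity.Theorems.KLProgrammeH10TwoPointLimitPerturbedCell

/-!
# Route `KLProgramme` — ENGINE child (stmt-HubbardSuperconductivity-20437 `KLRegimeEngineV17F2`): the TRANSVERSALITY ALTERNATIVE on the frame's Fermi curve
# — step (T1) of the `TwoShellFrameAreaAt` witness COMPLETE at the pointwise level (design note HOME/hubbard-kl-k3c2-p2/TWO-SHELL-FRAME-PORT.md §3;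
# the frame analogue of p1b's `klst_transversality_alternative`, with NO `sup|δ|` loss and constants from `FrameOK` (i)/(ii) only)

Cell `gate-hubbard-kl`, seat hubbard-kl-k3c2-p2 g15.  Frame `δ_K = −K.eval` (C⁰/C¹ binders `κ₀`, `κ₁ < Dt_min` on the closed square — N-uniform by
`…FrameGaussRate`), `GeomConstants (frameLevel μ K) Kc r₀ g₀ w`, a level `ν₂` with `|ν₂ − μ| < r₀` and its canonical polar curve
`p₂(θ) = u₂(θ)·dir θ`, `u₂ = perturbedFermiRadius δ_K ν₂`.  For a point `k` of the closed square in the `η`-shell of that level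
(`|ε₀(k) + δ_K(k) − ν₂| ≤ η`) — in the two-shell bound: `k = p(θ) − w` reduced to the cell — write the CROSSING SLOPE
`ℓ = DE(k)[p₂′(θ)] = 2 sin k₀·X₂′(θ) + 2 sin k₁·Y₂′(θ) + Dδ_K(k)[(X₂′, Y₂′)(θ)]` (`= G′(θ)` for `G(θ) = e_K(p₂(θ) − w)`).  Then
**`transversality_alternative_of_geomConstants`**: with
  `τ = ((π/2)·|ℓ|/((Dt_min − κ₁)u_min) + π·Kc·η/(Dt_min − κ₁)²)·(4 + κ₁)/(u_min·w)` and `R = (η + s_max·Dt_min·τ)/(Dt_min − κ₁)`,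
EITHER `|k − p₂(θ)|_∞ ≤ R` (COOPER: the transfer `w = p₂(θ) − k` is `R`-small mod `2πℤ²`) OR `|k − p₂(θ + π)|_∞ ≤ R` (CAUSTIC: `p₂(θ + π) = −p₂(θ)`,
`perturbed_point_add_pi`, so `w` is `R`-close to `2p₂(θ)` mod `2πℤ²`).  Mechanism: `k` lies on its OWN level curve `ν₁ = E(k)` at its polar angle `φ`
(`eq_perturbedFermiRadius_smul_dir`, ray uniqueness), `angle_alternative_level_of_geomConstants` bounds `min(‖φ − θ‖_𝕋, ‖φ − θ − π‖_𝕋) ≤ τ`, and p4's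
`cell_perturbed` converts the angular closeness into coordinate closeness on the level-`ν₂` curve.
Everything is PROVED; no definitions, no named facts; nothing asserts any stub or superconductivity.
References: BGM 2006 §2.4, §2.7 (2.69) [cite: BenfattoGiulianiMastropietro2006]; FST II App. B [cite: FeldmanSalmhoferTrubowitz1998].
-/

noncomputable section

namespace Summit.HubbardSuperconductivity.HubbardSuperconductivity.Theorems.PerturbedFermiCurve

set_option linter.dupNamespace false -- summit = problem name (single-conjunct summit), D-0017

open Real Set
open Literature.MathematicalPhysics.QuantumLattice Literature.MathematicalPhysics.QuantumLattice.BandSectorCounting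
open Literature.MathematicalPhysics.QuantumLattice.FermiRG
open Summit.HubbardSuperconductivity.HubbardSuperconductivity.Theorems.DispersionFlow
open Summit.HubbardSuperconductivity.HubbardSuperconductivity.Theorems.KLRegimeSplit

/-- **Central symmetry of the canonical polar curve of an even perturbation**: `p(θ + π) = −p(θ)`. [folklore] -/
theorem perturbed_point_add_pi {δ : (Fin 2 → ℝ) → ℝ} (heven : ∀ k, δ (-k) = δ k) (ν θ : ℝ) :
    perturbedFermiRadius δ ν (θ + π) • dir (θ + π) = -(perturbedFermiRadius δ ν θ • dir θ) := by
  rw [perturbedFermiRadius_add_pi heven, dir_add_pi, smul_neg]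

section Frame

variable {a b : ℝ} (B : BandBounds a b) {K : TrigPolyC4v} {κ₀ κ₁ : ℝ}
  (hδ : ∀ k : Fin 2 → ℝ, (∀ i, |k i| ≤ π) → |(fun k : Fin 2 → ℝ => -K.eval k) k| ≤ κ₀)
  (hκ : ∀ k : Fin 2 → ℝ, (∀ i, |k i| ≤ π) → ‖fderiv ℝ (fun k : Fin 2 → ℝ => -K.eval k) k‖ ≤ κ₁) (hκ₁ : κ₁ < B.Dtmin)
include B hδ hκ hκ₁

/-- **A point of the closed square lies on its OWN perturbed level curve at its polar angle**: `k = u_{E(k)}(φ)·dir φ`, `φ = arg k`,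
`u_{ν} = perturbedFermiRadius δ_K ν`, whenever `[E(k) − κ₀, E(k) + κ₀] ⊂ [a, b]` (ray uniqueness under `κ₁ < Dt_min`). [cite: BenfattoGiulianiMastropietro2006, §2.4 Lemma 2.1] -/
theorem eq_perturbedFermiRadius_smul_dir {k : Fin 2 → ℝ} (hk : ∀ i, |k i| ≤ π)
    (hlo : a ≤ sqDispersion k + -K.eval k - κ₀) (hhi : sqDispersion k + -K.eval k + κ₀ ≤ b) :
    k = perturbedFermiRadius (fun k : Fin 2 → ℝ => -K.eval k) (sqDispersion k + -K.eval k) (Complex.arg (⟨k 0, k 1⟩ : ℂ)) •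
      dir (Complex.arg (⟨k 0, k 1⟩ : ℂ)) := by
  set φ := Complex.arg (⟨k 0, k 1⟩ : ℂ) with hφ
  set ν₁ := sqDispersion k + -K.eval k with hν₁
  have hκ₀ : 0 ≤ κ₀ := (abs_nonneg _).trans (hδ k hk)
  have hνfree : sqDispersion k ∈ Icc a b := by
    have h2 := abs_le.1 (hδ k hk)
    simp only at h2
    constructor <;> linarith [h2.1, h2.2]
  have hkeq : k = bandFermiRadius (sqDispersion k) φ • dir φ := by
    have h := eq_bandFermiRadius_smul_dir_of_mem_square B hk hνfree 0
    simpa using h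
  set t := bandFermiRadius (sqDispersion k) φ with ht
  -- `t` is a Fermi point of `ε₀ + δ_K` at level `ν₁` on the ray `φ`
  have hlev : ν₁ - (fun k : Fin 2 → ℝ => -K.eval k) (t • dir φ) = sqDispersion k := by
    rw [← hkeq]; simp [hν₁]
  have ht' : IsBandFermiRadius (ν₁ - (fun k : Fin 2 → ℝ => -K.eval k) (t • dir φ)) φ t := by
    rw [hlev]
    obtain ⟨h1, h2⟩ := B.level hνfree
    exact isBandFermiRadius_bandFermiRadius h1 h2 φ
  have hδ1 : ContDiff ℝ 1 (fun k : Fin 2 → ℝ => -K.eval k) := contDiff_frameShift_toLp K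
  have hδc : Continuous (fun k : Fin 2 → ℝ => -K.eval k) := hδ1.continuous
  have huniq := eq_perturbedFermiRadius_of_isBandFermiRadius B hδc hδ hlo hhi (klrf_radialLipschitz hδ1 hκ φ) hκ₁ ht'
  rw [← huniq]; exact hkeq

variable {μ Kc r₀ g₀ w : ℝ} (hG : GeomConstants (frameLevel μ K) Kc r₀ g₀ w) {ν₂ : ℝ} (hν₂ : |ν₂ - μ| < r₀)
include hG hν₂

/-- **Transversality alternative on the frame's Fermi curve** (see the module docstring): for `k` in the closed square with
`|ε₀(k) + δ_K(k) − ν₂| ≤ η` (`ν₂ ± (κ₀ + η)` admissible) and crossing slope `ℓ = DE(k)[p₂′(θ)]`, either `|k − p₂(θ)|_∞ ≤ R` (Cooper) or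
`|k − p₂(θ+π)|_∞ ≤ R` (caustic), `R = (η + s_max·Dt_min·τ)/(Dt_min − κ₁)`, `τ = ((π/2)|ℓ|/((Dt_min−κ₁)u_min) + πKc·η/(Dt_min−κ₁)²)·(4+κ₁)/(u_min·w)`.
[cite: BenfattoGiulianiMastropietro2006, §2.7 (2.69)] -/
theorem transversality_alternative_of_geomConstants {k : Fin 2 → ℝ} {η : ℝ} (hk : ∀ i, |k i| ≤ π)
    (hshell : |sqDispersion k + -K.eval k - ν₂| ≤ η) (hlo : a ≤ ν₂ - κ₀ - η) (hhi : ν₂ + κ₀ + η ≤ b) (θ : ℝ) :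
    (∀ i : Fin 2, |k i - (perturbedFermiRadius (fun k : Fin 2 → ℝ => -K.eval k) ν₂ θ • dir θ) i| ≤
        (η + B.smax * B.Dtmin *
          ((π / 2 * |2 * Real.sin (k 0) * VXE (perturbedFermiRadius (fun k : Fin 2 → ℝ => -K.eval k) ν₂) θ +
              2 * Real.sin (k 1) * VYE (perturbedFermiRadius (fun k : Fin 2 → ℝ => -K.eval k) ν₂) θ +
              fderiv ℝ (fun k : Fin 2 → ℝ => -K.eval k) k
                ![VXE (perturbedFermiRadius (fun k : Fin 2 → ℝ => -K.eval k) ν₂) θ, VYE (perturbedFermiRadius (fun k : Fin 2 → ℝ => -K.eval k) ν₂) θ]| /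
              ((B.Dtmin - κ₁) * B.umin) + π * Kc * η / (B.Dtmin - κ₁) ^ 2) * (4 + κ₁) / (B.umin * w))) / (B.Dtmin - κ₁)) ∨
    (∀ i : Fin 2, |k i - (perturbedFermiRadius (fun k : Fin 2 → ℝ => -K.eval k) ν₂ (θ + π) • dir (θ + π)) i| ≤
        (η + B.smax * B.Dtmin *
          ((π / 2 * |2 * Real.sin (k 0) * VXE (perturbedFermiRadius (fun k : Fin 2 → ℝ => -K.eval k) ν₂) θ +
              2 * Real.sin (k 1) * VYE (perturbedFermiRadius (fun k : Fin 2 → ℝ => -K.eval k) ν₂) θ +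
              fderiv ℝ (fun k : Fin 2 → ℝ => -K.eval k) k
                ![VXE (perturbedFermiRadius (fun k : Fin 2 → ℝ => -K.eval k) ν₂) θ, VYE (perturbedFermiRadius (fun k : Fin 2 → ℝ => -K.eval k) ν₂) θ]| /
              ((B.Dtmin - κ₁) * B.umin) + π * Kc * η / (B.Dtmin - κ₁) ^ 2) * (4 + κ₁) / (B.umin * w))) / (B.Dtmin - κ₁)) := by
  set δ : (Fin 2 → ℝ) → ℝ := fun k : Fin 2 → ℝ => -K.eval k with hδdef
  set u₂ := perturbedFermiRadius δ ν₂ with hu₂def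
  set φ := Complex.arg (⟨k 0, k 1⟩ : ℂ) with hφ
  set ν₁ := sqDispersion k + -K.eval k with hν₁
  set u₁ := perturbedFermiRadius δ ν₁ with hu₁def
  set ℓ := 2 * Real.sin (k 0) * VXE u₂ θ + 2 * Real.sin (k 1) * VYE u₂ θ + fderiv ℝ δ k ![VXE u₂ θ, VYE u₂ θ] with hℓ
  have hη : 0 ≤ η := (abs_nonneg _).trans hshell
  have hκ₀ : 0 ≤ κ₀ := (abs_nonneg _).trans (hδ k hk)
  have hκ₁0 : 0 ≤ κ₁ := le_trans (norm_nonneg _) (hκ k hk)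
  have hD : 0 < B.Dtmin - κ₁ := sub_pos.2 hκ₁
  have hum := B.umin_pos
  have hw := hG.wmin_pos
  have hc : 0 < B.umin * w / (4 + κ₁) := by positivity
  -- admissibility of the two levels
  have hν₁η : |ν₁ - ν₂| ≤ η := hshell
  have hlo₁ : a ≤ ν₁ - κ₀ := by have := (abs_le.1 hν₁η).1; linarith
  have hhi₁ : ν₁ + κ₀ ≤ b := by have := (abs_le.1 hν₁η).2; linarith
  have hlo₂ : a ≤ ν₂ - κ₀ := by linarith
  have hhi₂ : ν₂ + κ₀ ≤ b := by linarith
  have hδc : Continuous δ := (contDiff_frameShift_toLp K (m := 0)).continuous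
  have hu₁ : ∀ ϑ, IsBandFermiRadius (ν₁ - δ (u₁ ϑ • dir ϑ)) ϑ (u₁ ϑ) := isBandFermiRadius_perturbedFermiRadius B hδc hδ hlo₁ hhi₁
  have hu₂ : ∀ ϑ, IsBandFermiRadius (ν₂ - δ (u₂ ϑ • dir ϑ)) ϑ (u₂ ϑ) := isBandFermiRadius_perturbedFermiRadius B hδc hδ hlo₂ hhi₂
  -- `k` on its own level curve at angle `φ`
  have hkeq : k = u₁ φ • dir φ := eq_perturbedFermiRadius_smul_dir B hδ hκ hκ₁ hk hlo₁ hhi₁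
  have hk0 : k 0 = XE u₁ φ := by rw [hkeq]; simp [XE, dir]
  have hk1 : k 1 = YE u₁ φ := by rw [hkeq]; simp [YE, dir]
  -- the angle alternative
  have hang := angle_alternative_level_of_geomConstants B hδ hκ hκ₁ hG hlo₁ hhi₁ hu₁ hlo₂ hhi₂ hu₂ rfl rfl hν₂ φ θ
  rw [← hk0, ← hk1, ← hkeq] at hang
  rw [← hℓ] at hang
  set τ := (π / 2 * |ℓ| / ((B.Dtmin - κ₁) * B.umin) + π * Kc * η / (B.Dtmin - κ₁) ^ 2) * (4 + κ₁) / (B.umin * w) with hτ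
  have hKc : 0 ≤ Kc := le_trans (norm_nonneg _) (hG.norm_iteratedFDeriv_le 0 0 (by norm_num))
  have hmin : min (torusDist (φ - θ)) (torusDist (φ - θ - π)) ≤ τ := by
    have h1 : B.umin * w / (4 + κ₁) * min (torusDist (φ - θ)) (torusDist (φ - θ - π)) ≤
        π / 2 * |ℓ| / ((B.Dtmin - κ₁) * B.umin) + π * Kc * η / (B.Dtmin - κ₁) ^ 2 := by
      refine hang.trans ?_
      have : π * Kc * |ν₁ - ν₂| / (B.Dtmin - κ₁) ^ 2 ≤ π * Kc * η / (B.Dtmin - κ₁) ^ 2 :=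
        div_le_div_of_nonneg_right (mul_le_mul_of_nonneg_left hν₁η (by positivity)) (by positivity)
      linarith
    rw [hτ, le_div_iff₀ (by positivity)]
    have h4 : 0 < 4 + κ₁ := by linarith
    have h2 := mul_le_mul_of_nonneg_right h1 h4.le
    have e : B.umin * w / (4 + κ₁) * min (torusDist (φ - θ)) (torusDist (φ - θ - π)) * (4 + κ₁) =
        min (torusDist (φ - θ)) (torusDist (φ - θ - π)) * (B.umin * w) := by field_simp
    rw [e] at h2
    linarith
  -- the Lipschitz form of `δ` on the square for `cell_perturbed`
  have hdiff : ∀ q : Fin 2 → ℝ, (∀ i, |q i| ≤ π) → DifferentiableAt ℝ δ q := fun q _ =>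
    ((contDiff_frameShift_toLp K (m := 1)).differentiable one_ne_zero) q
  have hLip : ∀ q q' : Fin 2 → ℝ, (∀ i, |q i| ≤ π) → (∀ i, |q' i| ≤ π) → |δ q - δ q'| ≤ κ₁ * ‖q - q'‖ :=
    fun q q' hq hq' => lipschitz_of_fderiv_le hdiff hκ hq hq'
  have hshell' : |sqDispersion k + δ k - ν₂| ≤ η := hshell
  rcases min_le_iff.1 hmin with hA | hB
  · -- COOPER: the polar angle of `k` is `τ`-close to `θ`
    left
    obtain ⟨m, hm⟩ := exists_torusDist_eq_abs (φ - θ)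
    have hang' : |Complex.arg (⟨k 0, k 1⟩ : ℂ) + m * (2 * π) - θ| ≤ τ := by
      rw [← hφ]
      have e : φ + m * (2 * π) - θ = φ - θ + m * (2 * π) := by ring
      rw [e, ← hm]; exact hA
    intro i
    exact cell_perturbed B hδ hLip hκ₁ hu₂ hk hshell' hlo hhi hang' i
  · -- CAUSTIC: the polar angle of `k` is `τ`-close to `θ + π`
    right
    obtain ⟨m, hm⟩ := exists_torusDist_eq_abs (φ - θ - π)
    have hang' : |Complex.arg (⟨k 0, k 1⟩ : ℂ) + m * (2 * π) - (θ + π)| ≤ τ := by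
      rw [← hφ]
      have e : φ + m * (2 * π) - (θ + π) = φ - θ - π + m * (2 * π) := by ring
      rw [e, ← hm]; exact hB
    intro i
    exact cell_perturbed B hδ hLip hκ₁ hu₂ hk hshell' hlo hhi hang' i

end Frame

end Summit.HubbardSuperconductivity.HubbardSuperconductivity.Theorems.PerturbedFermiCurve

end
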